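import Summits.BirchSwinnertonDyer.BirchSwinnertonDyer.Theorems.ClassRecordThreeCornerAtThreeKolyvaginRecord
import Summits.BirchSwinnertonDyer.Rank1Residual.X11b.RungK2Leaves

/-!
# Route `ClassRecordThree` (rung K2@3), crux 7 `CornerAtThree` (item 19111): the KOLYVAGIN ROAD on the
# non-surjective corner at `3`, file 3/3 — CLASS RECORD v4.1 and the K2@3 LEAF
# `X11b.MultiplicativeRankOneAtThree` with the corner inputs `{CornerStepLAt, CornerUpperAt}` REPLACED by the
# refined Kolyvagin conjecture on corner frames `{Z₃ᶜ, J₃ᶜ}`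
# (cell `bsd-stepL`, seat `bsd-stepL-corner-p1` g2; `--supports stmt-BirchSwinnertonDyer-19111`)

Files 1–2 (`ClassRecordThreeCornerAtThreeKolyvagin{,Record}.lean`) reduce the (T4″)@3 corner's typed missing
`3`-part to {Z₃ᶜ (Kolyvagin certificates of level `≤ t + 1` on corner frames, `M_∞ ≤ t`), J₃ᶜ (the
Jetchev direction `M_∞ ≥ t`), (Tw) `Three.CornerTwistAt`} through Kolyvagin's structure theorem under
irreducibility (`Cha2005.rmk25_…`, p422597, flag `Cha05-Rmk25-structure`). THIS FILE plugs that into the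
cell's class record and the rung leaf:

* `forall_bsdp_of_classRecord_v41_of_cornerKolyvagin` — x11b3-lead's CLASS RECORD v4.1
  (`Three.forall_bsdp_of_classRecord_v41`: `∀ (E,3) ∈ X11b, BSD(E,3)`) with its corner binders
  `hCL : ∀ W, CornerStepLAt W` and `hCU : ∀ W, CornerUpperAt W` REPLACED by `hZ` (Z₃ᶜ) and `hJ` (J₃ᶜ), plus
  the PUBLISHED Shimura reciprocity (`hrec`), Darmon 3.6 (`hD36`) and the two structure facts (`hChaL`,
  `hChaU`); the Matar–Nekovář binder `hMN` of v4.1 is no longer needed (the corner's `K`-bounds now come from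
  the structure facts). All other binders VERBATIM.
* **`multiplicativeRankOneAtThree_of_classRecord_of_cornerKolyvagin`** — the K2@3 LEAF
  `X11b.MultiplicativeRankOneAtThree` in the binder shape of the route's glue of record
  `X11b.multiplicativeRankOneAtThree_of_classRecord` (`RungK2Leaves.lean`; cruxes 1–6 of route
  `ClassRecordThree` as binders: `hReg` Schneider at `3`, `hDb`/`hDd` the descent residual, `hHb`/`hHd` the
  halves H2 ∧ H3, `hSh` Shimura displays, `hUα`/`hUγ`/`hU₀` the Euler halves) with crux 7's binders
  `(hCL, hCT, hCU)` REPLACED by `(hZ, hJ, hCT)` + `hrec`, `hD36`, `hChaL`, `hChaU` (and without `hMN`). Body: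
  the v4.5′ → v4.1 conversions of the cell (Hsieh 2014 + `Three.lambdaSupplyAt₃` + the descent residual ⟹ H1;
  `stepLAt_of_halves₃_of_classX11b`; `hEP` := `GaloisImage.EP.localEulerPoincareCharacteristic_adicCompletion`)
  composed with `forall_bsdp_of_classRecord_v41_of_cornerKolyvagin`. READING FOR THE PLANNER: route
  `ClassRecordThree` admits the re-cut of crux 7 `CornerAtThree ↦ CornerAtThreeKoly := (Z₃ᶜ on corner frames)
  ∧ (J₃ᶜ on corner frames) ∧ (∀ W, CornerTwistAt W)` with THIS theorem as the glue of the leaf — no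
  anticyclotomic-IMC-currency statement is then asked on the corner.

HONEST FRAMING. Z₃ᶜ and J₃ᶜ are hypothesis SHAPES (the two halves of the refined Kolyvagin conjecture
`M_∞ = t` on corner frames; NOT in print at `p ∣ N` nor for a non-surjective image); (Tw) is x11b3-p8's typed
`@[conjecture]` input; the structure facts are referee-flagged. Nothing here proves any crux; item 19111 does
NOT close; the leaf is NOT proved (every crux of the route remains a binder); BSD is not advanced by
bookkeeping; O2 OPEN; labels UNCHANGED; no census word moves. CONDITIONAL on every binder.

References: [Cha2005] Thm. 21, Rmk. 25; [MatarNekovar2019] Thm. 0.7, §0.9, §0.11; [McCallumLMS1991] §5 Cor.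
5.6; [Jetchev2008] Conj. 1.3; [Hsieh2014] Thm. 1; [Castella2018] Thm. 2.3, Thm. 3.2; [Skinner2016PacificMC]
Thm. A, Thm. C; [SteinWuthrich2013] Thm. 6.1, §4.2; [Disegni2020] Thm. 1; [BarriosEtAl2025] Thm. 5.1;
[Miller2011LMS] Def. 1.1; tree: `X11b/RungK2Leaves.lean`, `X11b/Three/{ClassRecordResidual, ClassRecordHalves,
ClassRecordHsieh, ClassRecordHsiehSupply, ClassRecordEP}.lean`.
-/

noncomputable section

open scoped Classical


namespace Summit.BirchSwinnertonDyer.Rank1Residual.X11b.Three.Koly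

open scoped NumberField

open WeierstrassCurve Literature.NumberTheory.EllipticCurves
  Literature.NumberTheory.EllipticCurves.ModularForms
  Literature.NumberTheory.EllipticCurves.Rank1Residual
  Literature.NumberTheory.EllipticCurves.Rank1Residual.Typed
  Literature.NumberTheory.EllipticCurves.Wuthrich2014
  Literature.NumberTheory.GaloisRepresentations Literature.NumberTheory.GaloisCohomology
  Summit.BirchSwinnertonDyer.Rank1Residual Summit.BirchSwinnertonDyer.Rank1Residual.X11b

/-- **CLASS RECORD v4.1 ON THE KOLYVAGIN CORNER ROAD**: `Three.forall_bsdp_of_classRecord` (v4, x11b3-p3)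
with its corner binders `hCs` ∕ `hCn` supplied by `missingPPartAt_three_of_corner_of_refinedKolyvaginFrames` —
i.e. x11b3-lead's `forall_bsdp_of_classRecord_v41` with the corner inputs `{CornerStepLAt, CornerUpperAt}`
REPLACED by `{Z₃ᶜ, J₃ᶜ}` (the refined Kolyvagin conjecture `M_∞ = t` on corner frames, two one-sided
hypothesis shapes) plus the PUBLISHED Shimura reciprocity (`hrec`), Darmon 3.6 (`hD36`) and the two cited
structure facts under irreducibility (`hChaL`, `hChaU`). All other binders VERBATIM v4.1's. Conclusion:
`BSD(E,3)` for every `(E,3) ∈` X11b. CONDITIONAL on every binder; nothing booked; labels UNCHANGED; O2 OPEN.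
[cite: Cha2005, Rmk. 25 (p. 175)] [cite: MatarNekovar2019, §0.11 (p. 457)] [cite: McCallumLMS1991, §5 Cor. 5.6 (p. 310)]
[cite: Skinner2016PacificMC, Thm. A and Thm. C (§1)] [cite: JetchevSkinnerWan2017, §7.4.1–7.4.2 (pp. 30–31)]
[cite: Miller2011LMS, Def. 1.1] -/
theorem forall_bsdp_of_classRecord_v41_of_cornerKolyvagin
    -- PUBLISHED: the twelve named facts of route p2
    (hGZ : ∀ (N : ℕ) [NeZero N] (W : WeierstrassCurve ℚ) (K : Type) [Field K] [NumberField K],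
      gross_zagier N W K)
    (hKo : ∀ (N : ℕ) [NeZero N] (W : WeierstrassCurve ℚ) (K : Type) [Field K] [NumberField K],
      kolyvagin N W K)
    (hB : ∀ (N : ℕ) [NeZero N] (W : WeierstrassCurve ℚ) (K : Type) [Field K] [NumberField K],
      Kolyvagin1990_padicValNat_card_sha_le N W K)
    (hSk : Skinner2016.thmC_padicValRat_bsd_rank_zero) (hWu : sha_dvd_analyticSha)
    (hGZK : rank_eq_analyticRank_of_analyticRank_le_one) (hmod : hasEntireLFunction_rat)
    (hnf : exists_isNewformOf) (hHL : HoffsteinLuo1997_exists_twist_L_one_ne_zero)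
    (hMaz : mazur_not_dvd_maninConstant_of_odd)
    (hPT : ∀ (K : Type) [Field K] [NumberField K], poitouTate_sum_localTatePairing_eq_zero K)
    (hEP : ∀ (K : Type) [Field K] [NumberField K] (v : IsDedekindDomain.HeightOneSpectrum (𝓞 K)),
      localEulerPoincareCharacteristic (v.adicCompletion K))
    -- PUBLISHED: Friedberg–Hoffstein, Barrios et al. 2025, road (a)'s five
    (hFH : friedbergHoffstein_exists_twist_ne_zero_inertAt)
    (hBR : BarriosEtAl2025.localTamagawaNumber_quadraticTwist_two_mem_of_goodReduction)
    (hSkA : Skinner2016.thmA_charIdeal_multiplicative) (hJn : SteinWuthrich2013.thm61_nonsplitMultiplicative)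
    (hHn : SteinWuthrich2013.exists_isMultCanonical) (hD : Disegni2020.thm1_padicBSD_rankOne_multiplicative)
    (hpar : nonempty_modularParametrizationData)
    -- PUBLISHED (this road): Shimura reciprocity at conductor 1, Darmon 3.6, the two structure facts
    (hrec : ∀ (N : ℕ) [NeZero N] (W : WeierstrassCurve ℚ) (K : Type) [Field K] [NumberField K],
      heegnerPointOfConductor_one_galoisConj N W K)
    (hD36 : ∀ (N : ℕ) [NeZero N] (W : WeierstrassCurve ℚ) (K : Type) [Field K] [NumberField K],
      phi_heegnerTau_mem_singularModuliField N W K)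
    (hChaL : Cha2005.rmk25_pow_dvd_card_sha_primary_of_certificate)
    (hChaU : Cha2005.rmk25_padicValNat_card_sha_primary_add_le_of_globalDivisibility)
    -- ROAD (a) NONSPLIT(3) ∧ (ram): ONE per-pair input
    (hReg : ∀ (W : WeierstrassCurve ℚ) [W.IsElliptic] [W.IsGloballyMinimal],
      ClassX11b W 3 → Ram W 3 → ¬ W.HasSplitMultiplicativeReductionAtPrime 3 →
        ClassClosure.RegulatorNonvanishingAt W 3)
    -- ROAD (b) SPLIT(3) ∧ (ram)
    (hL : ∀ (W : WeierstrassCurve ℚ) [W.IsElliptic] [W.IsGloballyMinimal],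
      ClassX11b W 3 → Ram W 3 → W.HasSplitMultiplicativeReductionAtPrime 3 → StepLAt W)
    (hSh : ∀ (W : WeierstrassCurve ℚ) [W.IsElliptic] [W.IsGloballyMinimal],
      ClassX11b W 3 → Ram W 3 → W.HasSplitMultiplicativeReductionAtPrime 3 → ¬ ShapeAlpha W →
        ¬ ShapeGamma W → 3 ∣ W.tamagawaProduct → P2ShimuraDisplaysAt W 3)
    (hUα : ∀ (W : WeierstrassCurve ℚ) [W.IsElliptic] [W.IsGloballyMinimal],
      ClassX11b W 3 → Ram W 3 → ShapeAlpha W → Typed.MissingUpperBoundAt W 3)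
    (hUγ : ∀ (W : WeierstrassCurve ℚ) [W.IsElliptic] [W.IsGloballyMinimal],
      ClassX11b W 3 → Ram W 3 → W.HasSplitMultiplicativeReductionAtPrime 3 → ¬ ShapeAlpha W →
        ShapeGamma W → Typed.MissingUpperBoundAt W 3)
    -- ROAD (d) `¬Ram ∧ Surj`
    (hL₀ : ∀ (W : WeierstrassCurve ℚ) [W.IsElliptic] [W.IsGloballyMinimal],
      ClassX11b W 3 → ¬ Ram W 3 → Surj W 3 → StepLAt W)
    (hU₀ : ∀ (W : WeierstrassCurve ℚ) [W.IsElliptic] [W.IsGloballyMinimal],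
      ClassX11b W 3 → Surj W 3 → ¬ Ram W 3 → Typed.MissingUpperBoundAt W 3)
    -- THE (T4″)@3 CORNER `¬Surj` ON THE KOLYVAGIN ROAD: Z₃ᶜ, J₃ᶜ, (Tw)
    (hZ : ∀ (W : WeierstrassCurve ℚ) [W.IsElliptic] [W.IsGloballyMinimal] [NeZero (W.conductorNorm ℤ)]
      (K : Type) [Field K] [NumberField K]
      (Dt : ModularParametrizationData W (W.conductorNorm ℤ)) (β : ℤ) (ι : K →+* ℂ),
      ClassX11b W 3 → ¬ Surj W 3 →
      IsImaginaryQuadratic K → SatisfiesHeegnerHypothesis (W.conductorNorm ℤ) K →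
      Odd (NumberField.discr K) →
      (4 * (W.conductorNorm ℤ : ℤ)) ∣ β ^ 2 - NumberField.discr K → ¬ (3 : ℤ) ∣ Dt.c →
      ∃ M : ℕ, M ≤ padicValNat 3 W.tamagawaProduct ∧ CertificateAt Dt β ι 3 M)
    (hJ : ∀ (W : WeierstrassCurve ℚ) [W.IsElliptic] [W.IsGloballyMinimal] [NeZero (W.conductorNorm ℤ)]
      (K : Type) [Field K] [NumberField K]
      (Dt : ModularParametrizationData W (W.conductorNorm ℤ)) (β : ℤ) (ι : K →+* ℂ),
      ClassX11b W 3 → ¬ Surj W 3 →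
      IsImaginaryQuadratic K → SatisfiesHeegnerHypothesis (W.conductorNorm ℤ) K →
      Odd (NumberField.discr K) →
      (4 * (W.conductorNorm ℤ : ℤ)) ∣ β ^ 2 - NumberField.discr K → ¬ (3 : ℤ) ∣ Dt.c →
      ∀ (s : ℕ), s ≤ padicValNat 3 W.tamagawaProduct →
        ∀ (n : ℕ) (d : KolyvaginHeegnerData Dt β ι n), Squarefree n →
          (∀ ℓ ∈ n.primeFactors, Zhang2014.IsKolyvaginPrime (W.conductorNorm ℤ) W K 3 ℓ ∧
            s ≤ Zhang2014.kolyvaginIndex W 3 ℓ) → PDiv d 3 s)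
    (hCT : ∀ (W : WeierstrassCurve ℚ) [W.IsElliptic] [W.IsGloballyMinimal], CornerTwistAt W)
    (W : WeierstrassCurve ℚ) [W.IsElliptic] [W.IsGloballyMinimal] (hX : ClassX11b W 3) :
    BSDp W 3 := by
  haveI : Fact (Nat.Prime 3) := ⟨Nat.prime_three⟩
  have hC := missingPPartAt_three_of_corner_of_refinedKolyvaginFrames hGZ hKo hGZK hmod hnf hHL hMaz hrec
    hD36 hChaL hChaU hZ hJ hCT
  exact forall_bsdp_of_classRecord hGZ hKo hB hSk hWu hGZK hmod hnf hHL hMaz hPT hEP hFH hBR hSkA hJn hHn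
    hD hpar hReg hL hSh hUα hUγ hL₀ hU₀ (fun W _ _ hX hns _ _ _ ↦ hC W hX hns)
    (fun W _ _ hX hns _ _ _ ↦ hC W hX hns) W hX

/-- **THE K2@3 LEAF ON THE KOLYVAGIN CORNER ROAD.** `X11b.MultiplicativeRankOneAtThree` (`∀ (E,3) ∈ X11b,
BSD(E,3)`) in the binder shape of the route's glue of record `X11b.multiplicativeRankOneAtThree_of_classRecord`
(`RungK2Leaves.lean`: the twenty published facts minus Matar–Nekovář; crux 1 `hReg` (Schneider at `3`, road
(a)); cruxes 2–3 `hDb`/`hDd` (descent residual) and `hHb`/`hHd` (H2 ∧ H3); crux 4 `hSh` (Shimura displays);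
crux 5 `hUα`/`hUγ`/`hU₀` (Euler halves)) with crux 7's corner binders `(hCL, hCT, hCU)` REPLACED by `(hZ, hJ,
hCT)` — Z₃ᶜ ∕ J₃ᶜ = the refined Kolyvagin conjecture `M_∞ = t` on corner frames, two hypothesis shapes — plus
the PUBLISHED Shimura reciprocity (`hrec`), Darmon 3.6 (`hD36`) and the structure facts under irreducibility
(`hChaL`, `hChaU`; Cha 2005 Rmk. 25 ∕ Matar–Nekovář 2019 §0.11; flag `Cha05-Rmk25-structure`). Proof: the
cell's v4.5′ → v4.1 conversions (H1 from Hsieh 2014 + `Three.lambdaSupplyAt₃` + the descent residual,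
`bdpExistsAt₃_of_hsieh2014_of_descent`; `stepLAt_of_halves₃_of_classX11b`; `hEP` supplied by
`GaloisImage.EP.localEulerPoincareCharacteristic_adicCompletion`) composed with
`forall_bsdp_of_classRecord_v41_of_cornerKolyvagin`. CONDITIONAL on every binder; proves NO crux; the leaf
is NOT established; nothing booked. [cite: Cha2005, Rmk. 25 (p. 175)] [cite: MatarNekovar2019, §0.11 (p. 457)]
[cite: McCallumLMS1991, §5 Cor. 5.6 (p. 310)] [cite: Hsieh2014, Thm. 1 (arXiv:1112.1580 pp. 3–4)]
[cite: Castella2018, Thm. 2.3 (p. 5), Thm. 3.2 (p. 9)] [cite: Skinner2016PacificMC, Thm. A and Thm. C (§1)]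
[cite: Miller2011LMS, Def. 1.1] -/
theorem multiplicativeRankOneAtThree_of_classRecord_of_cornerKolyvagin
    -- PUBLISHED: the named facts of the class record, WITHOUT `hEP` and WITHOUT Matar–Nekovář
    (hGZ : ∀ (N : ℕ) [NeZero N] (W : WeierstrassCurve ℚ) (K : Type) [Field K] [NumberField K],
      gross_zagier N W K)
    (hKo : ∀ (N : ℕ) [NeZero N] (W : WeierstrassCurve ℚ) (K : Type) [Field K] [NumberField K],
      kolyvagin N W K)
    (hB : ∀ (N : ℕ) [NeZero N] (W : WeierstrassCurve ℚ) (K : Type) [Field K] [NumberField K],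
      Kolyvagin1990_padicValNat_card_sha_le N W K)
    (hSk : Skinner2016.thmC_padicValRat_bsd_rank_zero) (hWu : sha_dvd_analyticSha)
    (hGZK : rank_eq_analyticRank_of_analyticRank_le_one) (hmod : hasEntireLFunction_rat)
    (hnf : exists_isNewformOf) (hHL : HoffsteinLuo1997_exists_twist_L_one_ne_zero)
    (hMaz : mazur_not_dvd_maninConstant_of_odd)
    (hPT : ∀ (K : Type) [Field K] [NumberField K], poitouTate_sum_localTatePairing_eq_zero K)
    (hFH : friedbergHoffstein_exists_twist_ne_zero_inertAt)
    (hBR : BarriosEtAl2025.localTamagawaNumber_quadraticTwist_two_mem_of_goodReduction)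
    (hSkA : Skinner2016.thmA_charIdeal_multiplicative) (hJn : SteinWuthrich2013.thm61_nonsplitMultiplicative)
    (hHn : SteinWuthrich2013.exists_isMultCanonical) (hD : Disegni2020.thm1_padicBSD_rankOne_multiplicative)
    (hpar : nonempty_modularParametrizationData)
    (hH : hsieh2014_exists_anticyclotomicPAdicLFunction)
    -- PUBLISHED (this road): Shimura reciprocity at conductor 1, Darmon 3.6, the two structure facts
    (hrec : ∀ (N : ℕ) [NeZero N] (W : WeierstrassCurve ℚ) (K : Type) [Field K] [NumberField K],
      heegnerPointOfConductor_one_galoisConj N W K)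
    (hD36 : ∀ (N : ℕ) [NeZero N] (W : WeierstrassCurve ℚ) (K : Type) [Field K] [NumberField K],
      phi_heegnerTau_mem_singularModuliField N W K)
    (hChaL : Cha2005.rmk25_pow_dvd_card_sha_primary_of_certificate)
    (hChaU : Cha2005.rmk25_padicValNat_card_sha_primary_add_le_of_globalDivisibility)
    -- CRUX 1 — ROAD (a) NONSPLIT(3) ∧ (ram): Schneider at 3
    (hReg : ∀ (W : WeierstrassCurve ℚ) [W.IsElliptic] [W.IsGloballyMinimal],
      ClassX11b W 3 → Ram W 3 → ¬ W.HasSplitMultiplicativeReductionAtPrime 3 →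
        ClassClosure.RegulatorNonvanishingAt W 3)
    -- CRUX 2 — the descent residual (H1-side) on roads (b)/(d)
    (hDb : ∀ (W : WeierstrassCurve ℚ) [W.IsElliptic] [W.IsGloballyMinimal],
      ClassX11b W 3 → Ram W 3 → W.HasSplitMultiplicativeReductionAtPrime 3 → HsiehDescentAt₃ W)
    (hDd : ∀ (W : WeierstrassCurve ℚ) [W.IsElliptic] [W.IsGloballyMinimal],
      ClassX11b W 3 → ¬ Ram W 3 → Surj W 3 → HsiehDescentAt₃ W)
    -- CRUX 3 — the halves H2 ∧ H3
    (hHb : ∀ (W : WeierstrassCurve ℚ) [W.IsElliptic] [W.IsGloballyMinimal],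
      ClassX11b W 3 → Ram W 3 → W.HasSplitMultiplicativeReductionAtPrime 3 →
        BDPValueAt₃ W ∧ IMCDivAt₃ W)
    (hHd : ∀ (W : WeierstrassCurve ℚ) [W.IsElliptic] [W.IsGloballyMinimal],
      ClassX11b W 3 → ¬ Ram W 3 → Surj W 3 → BDPValueAt₃ W ∧ IMCDivAt₃ W)
    -- CRUX 4 — Shimura displays on split ∧ (ram) ∧ pure-β
    (hSh : ∀ (W : WeierstrassCurve ℚ) [W.IsElliptic] [W.IsGloballyMinimal],
      ClassX11b W 3 → Ram W 3 → W.HasSplitMultiplicativeReductionAtPrime 3 → ¬ ShapeAlpha W →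
        ¬ ShapeGamma W → 3 ∣ W.tamagawaProduct → P2ShimuraDisplaysAt W 3)
    -- CRUX 5 — Euler-system halves (α, γ∖α split, ¬ram ∧ surj)
    (hUα : ∀ (W : WeierstrassCurve ℚ) [W.IsElliptic] [W.IsGloballyMinimal],
      ClassX11b W 3 → Ram W 3 → ShapeAlpha W → Typed.MissingUpperBoundAt W 3)
    (hUγ : ∀ (W : WeierstrassCurve ℚ) [W.IsElliptic] [W.IsGloballyMinimal],
      ClassX11b W 3 → Ram W 3 → W.HasSplitMultiplicativeReductionAtPrime 3 → ¬ ShapeAlpha W →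
        ShapeGamma W → Typed.MissingUpperBoundAt W 3)
    (hU₀ : ∀ (W : WeierstrassCurve ℚ) [W.IsElliptic] [W.IsGloballyMinimal],
      ClassX11b W 3 → Surj W 3 → ¬ Ram W 3 → Typed.MissingUpperBoundAt W 3)
    -- CRUX 7 RE-CUT — THE (T4″)@3 CORNER on the Kolyvagin road: Z₃ᶜ, J₃ᶜ, (Tw)
    (hZ : ∀ (W : WeierstrassCurve ℚ) [W.IsElliptic] [W.IsGloballyMinimal] [NeZero (W.conductorNorm ℤ)]
      (K : Type) [Field K] [NumberField K]
      (Dt : ModularParametrizationData W (W.conductorNorm ℤ)) (β : ℤ) (ι : K →+* ℂ),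
      ClassX11b W 3 → ¬ Surj W 3 →
      IsImaginaryQuadratic K → SatisfiesHeegnerHypothesis (W.conductorNorm ℤ) K →
      Odd (NumberField.discr K) →
      (4 * (W.conductorNorm ℤ : ℤ)) ∣ β ^ 2 - NumberField.discr K → ¬ (3 : ℤ) ∣ Dt.c →
      ∃ M : ℕ, M ≤ padicValNat 3 W.tamagawaProduct ∧ CertificateAt Dt β ι 3 M)
    (hJ : ∀ (W : WeierstrassCurve ℚ) [W.IsElliptic] [W.IsGloballyMinimal] [NeZero (W.conductorNorm ℤ)]
      (K : Type) [Field K] [NumberField K]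
      (Dt : ModularParametrizationData W (W.conductorNorm ℤ)) (β : ℤ) (ι : K →+* ℂ),
      ClassX11b W 3 → ¬ Surj W 3 →
      IsImaginaryQuadratic K → SatisfiesHeegnerHypothesis (W.conductorNorm ℤ) K →
      Odd (NumberField.discr K) →
      (4 * (W.conductorNorm ℤ : ℤ)) ∣ β ^ 2 - NumberField.discr K → ¬ (3 : ℤ) ∣ Dt.c →
      ∀ (s : ℕ), s ≤ padicValNat 3 W.tamagawaProduct →
        ∀ (n : ℕ) (d : KolyvaginHeegnerData Dt β ι n), Squarefree n →
          (∀ ℓ ∈ n.primeFactors, Zhang2014.IsKolyvaginPrime (W.conductorNorm ℤ) W K 3 ℓ ∧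
            s ≤ Zhang2014.kolyvaginIndex W 3 ℓ) → PDiv d 3 s)
    (hCT : ∀ (W : WeierstrassCurve ℚ) [W.IsElliptic] [W.IsGloballyMinimal], CornerTwistAt W) :
    MultiplicativeRankOneAtThree := by
  haveI : Fact (Nat.Prime 3) := ⟨Nat.prime_three⟩
  intro W _ _ hX
  exact forall_bsdp_of_classRecord_v41_of_cornerKolyvagin hGZ hKo hB hSk hWu hGZK hmod hnf hHL hMaz hPT
    GaloisImage.EP.localEulerPoincareCharacteristic_adicCompletion hFH hBR hSkA hJn hHn hD hpar hrec hD36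
    hChaL hChaU hReg
    (fun W _ _ hX hram hsplit ↦
      stepLAt_of_halves₃_of_classX11b hnf hKo hPT
        GaloisImage.EP.localEulerPoincareCharacteristic_adicCompletion hX
        (bdpExistsAt₃_of_hsieh2014_of_descent W hH lambdaSupplyAt₃ (hDb W hX hram hsplit))
        (hHb W hX hram hsplit).1 (hHb W hX hram hsplit).2)
    hSh hUα hUγ
    (fun W _ _ hX hnram hsurj ↦
      stepLAt_of_halves₃_of_classX11b hnf hKo hPT
        GaloisImage.EP.localEulerPoincareCharacteristic_adicCompletion hX
        (bdpExistsAt₃_of_hsieh2014_of_descent W hH lambdaSupplyAt₃ (hDd W hX hnram hsurj))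
        (hHd W hX hnram hsurj).1 (hHd W hX hnram hsurj).2)
    hU₀ hZ hJ hCT W hX

end Summit.BirchSwinnertonDyer.Rank1Residual.X11b.Three.Koly

end
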